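import Summits.QuantumFields.YangMills.Theorems.IR.MomentumPincerR2Slice

/-!
# Rung R2 of line `momentum-pincer`, file 2∕3: §2 reflection positivity (zero-momentum self-correlator non-negative, log-convex; geometric floor)
# and §2b the first datum `s_S(0)` bounded uniformly in the volume

Landed for item `stmt-QuantumFields-19354` (`--supports … --as helper`) by the LEAD prover ab-p1 under director-ym RULING g9-№2 ∕ №14 (3);
authored by ideator ym-ir-idea-5 g8 (line `momentum-pincer`, rung R2), MINIMAL CUT of the sorry-free workfile `Cruxes/IR/Lines/momentum_pincer_R2_transfer.lean`
v6 8c85df89ce78 (§0–§3d + §5; the by-product §4 «far field» is not landed), split in three files: `MomentumPincerR2Slice` (§0–§1) →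
`MomentumPincerR2RP` (§2–§2b) → `MomentumPincerR2Closure` (§3–§3d, §5: `noLightMoversSCTransfer_holds : NoLightMoversSCTransfer`).

HONEST: a strong-coupling rung (group-blind up to `a ≠ 1`); nothing here bears on `IR` at weak coupling, a continuum limit, or the Yang–Mills mass gap (Clay) — NOT proved; R4 closes only `BalabanLadder.UV`.
-/

noncomputable section

open Filter Topology MeasureTheory Finset
open Literature.MathematicalPhysics.QuantumFieldTheory Literature.MathematicalPhysics.QuantumLattice
open Literature.Probability.LatticeModels (Torus.proj Torus.proj_apply)
open Literature.Probability.LatticeModels.Site (supNorm supNorm_le_iff natAbs_le_supNorm norm_eq_supNorm)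
open Summit.QuantumFields.YangMills.Theorems.SoloBlind

namespace Summit.QuantumFields.YangMills.Cruxes.IR.MomentumPincerRung

variable {G : Type} [Group G] [TopologicalSpace G] [IsTopologicalGroup G] [CompactSpace G]
  [MeasurableSpace G] [BorelSpace G]

/-! ## §2 Reflection positivity: the zero-momentum self-correlator is non-negative and log-convex; geometric floor -/

/-- `s_S(t) ≥ 0` for a time-zero spatial species (`β ≥ 0`, `S ≥ 1`). [folklore consequence of OS positivity] -/
theorem sliceSumCorr_self_nonneg {N : ℕ} (ρ : G →* Matrix (Fin N) (Fin N) ℂ) (hρ : Continuous ρ) {β : ℝ}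
    (hβ : 0 ≤ β) {S : ℕ} (hS : 1 ≤ S) (P : YMSpecies G) (hP : ∀ e ∈ P.supp, e.1 0 = 0 ∧ e.2 ≠ 0) (t : ℕ) :
    0 ≤ sliceSumCorr ρ β S P.F P.F t := by
  have h := latticeConnectedCorr_self_nonneg ρ hρ hβ hS (sliceSpecies S P) (sliceSpecies_timeZeroSpatial S hP) t
  rw [latticeConnectedCorr_sliceSpecies ρ hρ] at h
  have hN : (0 : ℝ) < Fintype.card (Fin 3 → ZMod (2 * S + 1)) := by exact_mod_cast Fintype.card_pos
  exact (mul_nonneg_iff_of_pos_left hN).mp h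

/-- `s_S(t+1)² ≤ s_S(t) · s_S(t+2)` for `t + 2 ≤ 2S+1`, time-zero spatial species (`β ≥ 0`, `S ≥ 1`).
[folklore consequence of OS positivity] -/
theorem sliceSumCorr_self_logConvex {N : ℕ} (ρ : G →* Matrix (Fin N) (Fin N) ℂ) (hρ : Continuous ρ) {β : ℝ}
    (hβ : 0 ≤ β) {S : ℕ} (hS : 1 ≤ S) (P : YMSpecies G) (hP : ∀ e ∈ P.supp, e.1 0 = 0 ∧ e.2 ≠ 0) (t : ℕ)
    (ht : t + 2 ≤ 2 * S + 1) :
    sliceSumCorr ρ β S P.F P.F (t + 1) ^ 2 ≤ sliceSumCorr ρ β S P.F P.F t * sliceSumCorr ρ β S P.F P.F (t + 2) := by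
  have h := latticeConnectedCorr_self_logConvex ρ hρ hβ hS (sliceSpecies S P) (sliceSpecies_timeZeroSpatial S hP) t ht
  simp only [latticeConnectedCorr_sliceSpecies ρ hρ] at h
  set N : ℝ := ((Fintype.card (Fin 3 → ZMod (2 * S + 1)) : ℕ) : ℝ) with hNdef
  have hN : (0 : ℝ) < N := by rw [hNdef]; exact_mod_cast Fintype.card_pos
  have h2 : N ^ 2 * sliceSumCorr ρ β S P.F P.F (t + 1) ^ 2 ≤
      N ^ 2 * (sliceSumCorr ρ β S P.F P.F t * sliceSumCorr ρ β S P.F P.F (t + 2)) := by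
    have e1 : (N * sliceSumCorr ρ β S P.F P.F (t + 1)) ^ 2 = N ^ 2 * sliceSumCorr ρ β S P.F P.F (t + 1) ^ 2 := by
      ring
    have e2 : N * sliceSumCorr ρ β S P.F P.F t * (N * sliceSumCorr ρ β S P.F P.F (t + 2)) =
        N ^ 2 * (sliceSumCorr ρ β S P.F P.F t * sliceSumCorr ρ β S P.F P.F (t + 2)) := by ring
    rw [← e1, ← e2]; exact h
  exact le_of_mul_le_mul_left h2 (by positivity)

/-- **Geometric floor from two-point data** (discrete): a non-negative multiplicatively convex sequence on `[0, K]`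
with `a 0 ≤ s_max` and `0 < f₁ ≤ a 1` obeys `a n ≥ (f₁/s_max)^{n-1} f₁` for `1 ≤ n ≤ K` (`s_max > 0`).
[elementary; tree `mulConvex_ratio_floor` + `mulConvex_lower_envelope`] -/
theorem geometric_floor_of_two_point {a : ℕ → ℝ} {K : ℕ} (h0 : ∀ k, k ≤ K → 0 ≤ a k)
    (hconv : ∀ k, k + 2 ≤ K → a (k + 1) ^ 2 ≤ a k * a (k + 2)) {sMax f₁ : ℝ} (hsMax : 0 < sMax)
    (hf : 0 < f₁) (hmax : a 0 ≤ sMax) (hfloor : f₁ ≤ a 1) :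
    ∀ n, 1 ≤ n → n ≤ K → (f₁ / sMax) ^ (n - 1) * f₁ ≤ a n := by
  intro n hn hnK
  set θ : ℝ := f₁ / sMax with hθdef
  have hθ : 0 < θ := div_pos hf hsMax
  have hfl : θ ^ (1 - 0) * a 0 ≤ a 1 := by
    rw [Nat.sub_zero, pow_one]
    calc θ * a 0 ≤ θ * sMax := mul_le_mul_of_nonneg_left hmax hθ.le
      _ = f₁ := by rw [hθdef, div_mul_cancel₀ _ hsMax.ne']
      _ ≤ a 1 := hfloor
  have hstep : ∀ q, 1 ≤ q → q + 1 ≤ K → θ * a q ≤ a (q + 1) :=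
    mulConvex_ratio_floor h0 hconv hθ zero_lt_one hfl
  have henv := mulConvex_lower_envelope hθ.le hstep n hn hnK
  calc θ ^ (n - 1) * f₁ ≤ θ ^ (n - 1) * a 1 := mul_le_mul_of_nonneg_left hfloor (pow_nonneg hθ.le _)
    _ ≤ a n := henv

/-! ## §2b The first datum for free: `s_S(0)` is bounded uniformly in the volume (β-uniform SC clustering) -/

/-- The `t = 0` slice term in Osterwalder–Seiler form: `Cov(P∘θ_v, P) = ⟨P · P∘θ_v⟩ − ⟨P⟩⟨P∘θ_v⟩`. -/
theorem latticeConnectedCorr_shift_left_zero {N : ℕ} (ρ : G →* Matrix (Fin N) (Fin N) ℂ) (β : ℝ) (L : ℕ) [NeZero L]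
    (F : LGConfig 4 G → ℝ) (v : Fin 4 → ℤ) :
    latticeConnectedCorr ρ β L (fun U => F (configShift v U)) F 0 =
      wilsonExpectation ρ β (toTorusObservable L fun U => F U * F (configShift v U)) -
        wilsonExpectation ρ β (toTorusObservable L F) *
          wilsonExpectation ρ β (toTorusObservable L (F ∘ configShift v)) := by
  rw [latticeConnectedCorr_eq_wilsonExpectation]
  have h0 : ∀ U : LGConfig 4 G, configShift (-Pi.single (0 : Fin 4) ((0 : ℕ) : ℤ)) U = U := by
    intro U; funext e; simp [configShift_apply]
  simp only [h0, Function.comp_def, mul_comm]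

/-- **F0 — the `t = 0` datum is free.**  For every species `P` there are `β₀ > 0` and `s_max` with
`s_S(0) = Σ_{x⃗} Cov(P_{(0,x⃗)}, P) ≤ s_max` for all `0 ≤ β ≤ β₀` and ALL `S` — from the β-uniform strong-coupling
clustering `torusClustering_uniform_fixedRate` (R1's engine) and `Σ_{x⃗ ∈ 𝕋³} e^{-‖x⃗‖_∞} ≤ (Σ_{k ∈ ℤ} e^{-|k|/3})³`. -/
theorem sliceSumCorr_zero_le {N : ℕ} (ρ : G →* Matrix (Fin N) (Fin N) ℂ) (hρ : Continuous ρ) (P : YMSpecies G) :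
    ∃ β₀ sMax : ℝ, 0 < β₀ ∧ ∀ β : ℝ, 0 ≤ β → β ≤ β₀ → ∀ S : ℕ, sliceSumCorr ρ β S P.F P.F 0 ≤ sMax := by
  obtain ⟨β₀, hβ₀, h⟩ := torusClustering_uniform_fixedRate (d := 4) ρ (by norm_num) hρ
  obtain ⟨C, hC⟩ := h P.F P.F ⟨P.supp, P.isCylinder⟩ ⟨P.supp, P.isCylinder⟩ P.measurable P.measurable
    P.bounded P.bounded
  -- the geometric weight `q = e^{-1/3}`
  obtain ⟨q, hq0, hq1, hqexp⟩ : ∃ q : ℝ, 0 ≤ q ∧ q < 1 ∧ ∀ n : ℕ, Real.exp (n * (-1 / 3 : ℝ)) = q ^ n :=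
    ⟨Real.exp (-1 / 3), (Real.exp_pos _).le, Real.exp_lt_one_iff.mpr (by norm_num),
      fun n => Real.exp_nat_mul _ _⟩
  have hg0 : ∀ k : ℤ, 0 ≤ q ^ k.natAbs := fun k => pow_nonneg hq0 _
  have hgs : Summable fun k : ℤ => q ^ k.natAbs := by
    refine Summable.of_nat_of_neg ?_ ?_
    · simpa [Int.natAbs_natCast] using summable_geometric_of_lt_one hq0 hq1
    · simpa [Int.natAbs_neg, Int.natAbs_natCast] using summable_geometric_of_lt_one hq0 hq1
  have hC0 : 0 ≤ C := by
    have h1 := hC 0 le_rfl hβ₀.le 0 0 (by simp)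
    simp only [norm_zero, neg_zero, Real.exp_zero, mul_one] at h1
    exact (abs_nonneg _).trans h1
  refine ⟨β₀, C * ∏ _j : Fin 3, ∑' k : ℤ, q ^ k.natAbs, hβ₀, fun β hβ hββ₀ S => ?_⟩
  haveI : NeZero (2 * S + 1) := ⟨by omega⟩
  -- per-site bound `Cov(P_{(0,x⃗)}, P) ≤ C Π_j q^{|x_j|}`
  have hx : ∀ x : Fin 3 → ZMod (2 * S + 1),
      latticeConnectedCorr ρ β (2 * S + 1) (fun U => P.F (configShift (spatialVec S x) U)) P.F 0 ≤
        C * ∏ j : Fin 3, q ^ ((x j).valMinAbs).natAbs := by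
    intro x
    have hnorm : 2 * ‖spatialVec S x‖ < ((2 * S : ℕ) : ℝ) + 1 := by
      have hle : supNorm (spatialVec S x) ≤ S := by
        rw [supNorm_le_iff]
        intro i
        by_cases hi : i = 0
        · subst hi; simp [spatialVec]
        · simp only [spatialVec, dif_neg hi]
          have := ZMod.natAbs_valMinAbs_le (x (i.pred hi))
          omega
      rw [norm_eq_supNorm]
      have : (supNorm (spatialVec S x) : ℝ) ≤ S := by exact_mod_cast hle
      push_cast; linarith
    have key := hC β hβ hββ₀ (2 * S) (spatialVec S x) hnorm
    have hexp : Real.exp (-‖spatialVec S x‖) ≤ ∏ j : Fin 3, q ^ ((x j).valMinAbs).natAbs := by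
      have h1 : ∀ j : Fin 3, ((x j).valMinAbs).natAbs ≤ supNorm (spatialVec S x) := by
        intro j
        have := natAbs_le_supNorm (spatialVec S x) j.succ
        simpa [spatialVec, Fin.succ_ne_zero] using this
      have h2 : (∑ j : Fin 3, ((x j).valMinAbs).natAbs) ≤ 3 * supNorm (spatialVec S x) :=
        calc (∑ j : Fin 3, ((x j).valMinAbs).natAbs) ≤ ∑ _j : Fin 3, supNorm (spatialVec S x) :=
              Finset.sum_le_sum fun j _ => h1 j
          _ = 3 * supNorm (spatialVec S x) := by simp
      have hsum : ((∑ j : Fin 3, ((x j).valMinAbs).natAbs : ℕ) : ℝ) ≤ 3 * ‖spatialVec S x‖ := by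
        rw [norm_eq_supNorm]; exact_mod_cast h2
      calc Real.exp (-‖spatialVec S x‖)
          ≤ Real.exp ((∑ j : Fin 3, ((x j).valMinAbs).natAbs : ℕ) * (-1 / 3 : ℝ)) :=
            Real.exp_le_exp.mpr (by linarith)
        _ = q ^ (∑ j : Fin 3, ((x j).valMinAbs).natAbs) := hqexp _
        _ = ∏ j : Fin 3, q ^ ((x j).valMinAbs).natAbs := (Finset.prod_pow_eq_pow_sum _ _ _).symm
    calc latticeConnectedCorr ρ β (2 * S + 1) (fun U => P.F (configShift (spatialVec S x) U)) P.F 0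
        = _ := latticeConnectedCorr_shift_left_zero ρ β (2 * S + 1) P.F (spatialVec S x)
      _ ≤ _ := le_abs_self _
      _ ≤ C * Real.exp (-‖spatialVec S x‖) := key
      _ ≤ C * ∏ j : Fin 3, q ^ ((x j).valMinAbs).natAbs := mul_le_mul_of_nonneg_left hexp hC0
  -- the one-dimensional sum over `ZMod (2S+1)` against the sum over `ℤ`
  have hZ : ∑ a : ZMod (2 * S + 1), q ^ (a.valMinAbs).natAbs ≤ ∑' k : ℤ, q ^ k.natAbs := by
    have hinj : Function.Injective (ZMod.valMinAbs : ZMod (2 * S + 1) → ℤ) := by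
      intro a b hab
      have := congrArg (fun k : ℤ => (k : ZMod (2 * S + 1))) hab
      simpa [ZMod.coe_valMinAbs] using this
    calc ∑ a : ZMod (2 * S + 1), q ^ (a.valMinAbs).natAbs
        = ∑ k ∈ Finset.univ.image (ZMod.valMinAbs : ZMod (2 * S + 1) → ℤ), q ^ k.natAbs := by
          rw [Finset.sum_image fun a _ b _ hab => hinj hab]
      _ ≤ ∑' k : ℤ, q ^ k.natAbs := Summable.sum_le_tsum _ (fun k _ => hg0 k) hgs
  -- sum up
  calc sliceSumCorr ρ β S P.F P.F 0
      = ∑ x : Fin 3 → ZMod (2 * S + 1), latticeConnectedCorr ρ β (2 * S + 1)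
          (fun U => P.F (configShift (spatialVec S x) U)) P.F 0 := rfl
    _ ≤ ∑ x : Fin 3 → ZMod (2 * S + 1), C * ∏ j : Fin 3, q ^ ((x j).valMinAbs).natAbs :=
        Finset.sum_le_sum fun x _ => hx x
    _ = C * ∏ j : Fin 3, ∑ a : ZMod (2 * S + 1), q ^ (a.valMinAbs).natAbs := by
        rw [← Finset.mul_sum]
        congr 1
        exact (Fintype.prod_sum fun (_ : Fin 3) (a : ZMod (2 * S + 1)) => q ^ (a.valMinAbs).natAbs).symm
    _ ≤ C * ∏ _j : Fin 3, ∑' k : ℤ, q ^ k.natAbs := by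
        refine mul_le_mul_of_nonneg_left (Finset.prod_le_prod (fun j _ => ?_) fun j _ => hZ) hC0
        exact Finset.sum_nonneg fun a _ => hg0 _

end Summit.QuantumFields.YangMills.Cruxes.IR.MomentumPincerRung

end
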